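import Literature.NumberTheory.EllipticCurves.TateCurve.InertiaTorsionOfTateParameterPower
import Literature.NumberTheory.EllipticCurves.TateCurve.RankOneTorsionSubgroups
import Literature.NumberTheory.EllipticCurves.TateCurve.SplitOfRationalTorsion
import HarnessLib

/-!
# Route `ErratumRoadFive` (rung K2), crux `NonSurjCorner` (item stmt-BirchSwinnertonDyer-19065):
# TATE-CURVE LEMMAS FOR THE LOCAL CHARACTERS OF A CORNER PAIR — stable lines of `E_q[l]` away from
# `μ_l` are pointwise fixed; two stable lines, one moved ⇒ the other fixed; `γ` square ⇒ split;
# the sign-equivariant `E ≃ E_q` packaged with `q` and `√γ`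
# (cell `bsd-stepL`, seat `bsd-stepL-corner5-p2` g3, WIDTH-LEVER lane B «class-level road»;
# `--supports stmt-BirchSwinnertonDyer-19065 --as helper`; file 1 of 2, sequel `…LocalCharacter`)

WHY THIS FILE. Tools for `ErratumRoadFiveNonSurjCornerLocalCharacter.lean`, which pins the character of
`Γ_{ℚ_p}` on the inertia-fixed line `E[p]^{I_p}` of a corner pair as the Tate twist sign `χ_γ`. All
statements here are about the Tate curve `E_q` over a complete ultrametric field of characteristic `0`
(or a number field at a multiplicative place) and are classical (Silverman *ATAEC* V.3–V.5, [GenEll] §3):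

* §1 `smul_eq_of_mem_of_forall_not_mem_roots`: for a `q^ℤ`-uniformisation `φ : K̄^× → M`, a
  `Γ_K`-stable subgroup of order `l` meeting `φ(μ_l)` in `0` is POINTWISE FIXED by `Γ_K` (the
  Kummer-cocycle step of [GenEll] Lemma 3.2 (i): `σP − P = φ(σw/w) ∈ N ∩ φ(μ_l)`);
  `eq_zero_of_mem_of_mem_of_ne`: distinct subgroups of prime order meet in `0`.
* §1b `forall_smul_eq_of_two_stable_lines`: on `E_q(K̄)`, of two DISTINCT stable subgroups of prime
  order, if one is moved by `Γ_K` the other is pointwise fixed (the moved one cannot avoid `φ(μ_l)`… see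
  the docstring).
* §2 `hasSplitMultiplicativeReductionAt_of_isSquare_gamma` (V.5.3 (b) (ii) ⇒ (iii) at a place of a
  number field, extracted from the tree's `hasSplitMultiplicativeReductionAt_of_card_torsion_of_corV54`),
  `exists_toAlgEquiv_ne_of_not_split` (non-split ⇒ some `σ ∈ Γ_{K_v}` moves `√γ`), and
  `exists_tateParameter_sq_eq_gamma_signEquiv` (V.5.3 (a) + V.5.2 (c): `q`, `t = √γ`, and
  `e : E(K̄_v) ≃+ E_q(K̄_v)` with `σ • e(P) = χ_γ(σ) • e(σ • P)`).

HONEST FRAMING: classical Tate-curve lemmas (theorems only, no definition, no named fact); nothing here is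
about BSD, the crux or a registered stub.

References: [SilvermanATAEC1994] V.3.1 (c),(d), Lemma V.5.1, Lemma V.5.2 (c), Thm. V.5.3, Cor. V.5.4
(PDF pp. 394–410), proof of Prop. V.6.1 (PDF p. 411); [MochizukiGenEll2010] §3 Lemma 3.2 (i); tree files
`TateCurve/{RankOneTorsionSubgroups, SplitOfRationalTorsion, UniformizationHolds, Uniformization,
NumberFieldUniformizationTwisted}`.
-/

set_option autoImplicit false

noncomputable section

open scoped Classical NumberField
open IsDedekindDomain Field WeierstrassCurve

namespace Literature.NumberTheory.EllipticCurves.TateCurve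

open SteinWuthrich2013

universe u v

/-! ### §1. Two lemmas on stable lines of a `q^ℤ`-uniformised module -/

section Shape

variable {K : Type u} [NormedField K] [CharZero K] {q : K}
  {M : Type v} [AddCommGroup M] [MulAction (absoluteGaloisGroup K) M]

omit [CharZero K] in
/-- **A stable line meeting `μ_l` trivially is pointwise fixed** (the Kummer-cocycle step in the proof
of [GenEll] Lemma 3.2 (i)). For a `q^ℤ`-uniformisation `φ : K̄^× → M` (surjective, kernel `q^ℤ`,
`Γ_K`-equivariant), `l` and a `Γ_K`-stable subgroup `N ≤ M` of order `l` with
`N ∩ φ(μ_l(K̄)) = 0`: every `P ∈ N` is fixed by `Γ_K` — `σP − P = φ(σw/w)` (`P = φ(w)`, `w^l ∈ q^ℤ`) lies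
in `N ∩ φ(μ_l) = 0`. [cite: MochizukiGenEll2010, §3 Lem 3.2 (i) p.15]
[cite: SilvermanATAEC1994, proof of Prop. V.6.1 (PDF p. 411)] -/
theorem smul_eq_of_mem_of_forall_not_mem_roots (hq0 : q ≠ 0)
    (φ : Additive (AlgebraicClosure K)ˣ →+ M) (hsurj : Function.Surjective φ)
    (hker : ∀ u : (AlgebraicClosure K)ˣ, φ (Additive.ofMul u) = 0 ↔
      ∃ n : ℤ, (u : AlgebraicClosure K) = algebraMap K (AlgebraicClosure K) q ^ n)
    (hequiv : ∀ (σ : absoluteGaloisGroup K) (u : (AlgebraicClosure K)ˣ),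
      σ • φ (Additive.ofMul u) =
        φ (Additive.ofMul (Units.map
          (absoluteGaloisGroup.toAlgEquiv K σ : AlgebraicClosure K →* AlgebraicClosure K) u)))
    {l : ℕ} (N : AddSubgroup M) (hN : Nat.card N = l)
    (hstab : ∀ σ : absoluteGaloisGroup K, ∀ x ∈ N, σ • x ∈ N)
    (hmeet : ∀ Q ∈ N, ∀ u : (AlgebraicClosure K)ˣ, u ^ l = 1 → φ (Additive.ofMul u) = Q → Q = 0)
    (σ : absoluteGaloisGroup K) {P : M} (hPN : P ∈ N) : σ • P = P := by
  set Kb := AlgebraicClosure K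
  set qb : Kb := algebraMap K Kb q with hqb_def
  have hqb0 : qb ≠ 0 := (_root_.map_ne_zero _).mpr hq0
  have hPl : l • P = 0 := by
    have h := card_nsmul_eq_zero' (x := (⟨P, hPN⟩ : N))
    rw [hN] at h
    exact congrArg Subtype.val h
  -- a lift `w` of `P`, with `w ^ l = q ^ m`
  obtain ⟨a, ha⟩ := hsurj P
  set w : Kbˣ := Additive.toMul a with hw_def
  have hw : φ (Additive.ofMul w) = P := by simpa [hw_def] using ha
  have hwl0 : φ (Additive.ofMul (w ^ l)) = 0 := by rw [ofMul_pow, map_nsmul, hw, hPl]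
  obtain ⟨m, hm⟩ := (hker _).mp hwl0
  rw [Units.val_pow_eq_pow_val] at hm
  set τ := absoluteGaloisGroup.toAlgEquiv K σ with hτ_def
  have hD : σ • P - P = φ (Additive.ofMul (Units.map (τ : Kb →* Kb) w * w⁻¹)) := by
    rw [ofMul_mul, ofMul_inv, map_add, map_neg, ← hw, hequiv, sub_eq_add_neg]
  have hζ : (Units.map (τ : Kb →* Kb) w * w⁻¹) ^ l = 1 := by
    ext
    rw [Units.val_pow_eq_pow_val, Units.val_mul, Units.coe_map, MonoidHom.coe_coe, Units.val_one,
      mul_pow, ← map_pow, hm, Units.val_inv_eq_inv_val, inv_pow, hm, map_zpow₀, hqb_def,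
      AlgEquiv.commutes, mul_inv_cancel₀ (zpow_ne_zero m hqb0)]
  have hDN : σ • P - P ∈ N := N.sub_mem (hstab σ P hPN) hPN
  exact sub_eq_zero.mp (hmeet _ hDN _ hζ hD.symm)

omit [CharZero K] [MulAction (absoluteGaloisGroup K) M] in
/-- Two DISTINCT subgroups of the same prime order `l` meet in `0` (a non-zero common element
generates both). [folklore] -/
theorem eq_zero_of_mem_of_mem_of_ne {l : ℕ} (hl : l.Prime) {N N' : AddSubgroup M}
    (hN : Nat.card N = l) (hN' : Nat.card N' = l) (hne : N ≠ N') {Q : M} (hQ : Q ∈ N)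
    (hQ' : Q ∈ N') : Q = 0 := by
  by_contra hQ0
  haveI : Fact l.Prime := ⟨hl⟩
  haveI : Finite N := Nat.finite_of_card_ne_zero (by rw [hN]; exact hl.ne_zero)
  haveI : Finite N' := Nat.finite_of_card_ne_zero (by rw [hN']; exact hl.ne_zero)
  have hQl : l • Q = 0 := by
    have h := card_nsmul_eq_zero' (x := (⟨Q, hQ⟩ : N))
    rw [hN] at h
    exact congrArg Subtype.val h
  have hord : addOrderOf Q = l := addOrderOf_eq_prime hQl hQ0
  have h1 : AddSubgroup.zmultiples Q = N :=
    AddSubgroup.eq_of_le_of_card_ge ((AddSubgroup.zmultiples_le).mpr hQ)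
      (by rw [hN, Nat.card_zmultiples, hord])
  have h2 : AddSubgroup.zmultiples Q = N' :=
    AddSubgroup.eq_of_le_of_card_ge ((AddSubgroup.zmultiples_le).mpr hQ')
      (by rw [hN', Nat.card_zmultiples, hord])
  exact hne (h1.symm.trans h2)

end Shape

/-! ### §1b. Two stable lines on the Tate curve, one inertially fixed and one not: the fixed one is
`Γ_K`-trivial -/

section TateCurve

variable {K : Type u} [NontriviallyNormedField K] [CompleteSpace K] [IsUltrametricDist K]
  [CharZero K] {q : K}

/-- **Two stable lines of `E_q[l]`: if one is moved, the other is pointwise fixed.** For the Tate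
curve `E_q` over a complete ultrametric field `K` of characteristic `0` (`0 < ‖q‖ < 1`), a prime `l` and
two DISTINCT `Γ_K`-stable subgroups `N₀, N₁ ≤ E_q(K̄)` of order `l` such that `N₁` is NOT pointwise fixed
by `Γ_K`: then `N₀` IS pointwise fixed by `Γ_K`. (With Tate's `φ` and the line `φ(μ_l)`
(`exists_subgroup_coe_eq_image_rootsOfUnity`): if `N₀ = φ(μ_l)` then `N₁ ∩ φ(μ_l) = 0`, so `N₁` is
pointwise fixed (`smul_eq_of_mem_of_forall_not_mem_roots`) — excluded; hence `N₀ ∩ φ(μ_l) = 0` and `N₀`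
is pointwise fixed.) In the application `N₀` is the image of `E[p]^{I_p}` and `N₁` the image of the
ramified line, moved by the inertia group.
[cite: MochizukiGenEll2010, §3 Lemma 3.2 (i)] [cite: SilvermanATAEC1994, Thm. V.3.1 (c),(d) (PDF pp. 394–395)] -/
theorem forall_smul_eq_of_two_stable_lines (hq0 : q ≠ 0) (hq : ‖q‖ < 1) {l : ℕ} (hl : l.Prime)
    (N₀ N₁ : AddSubgroup (geomPoints (tateCurve q))) (h₀ : Nat.card N₀ = l) (h₁ : Nat.card N₁ = l)
    (hne : N₀ ≠ N₁)
    (hst₀ : ∀ σ : absoluteGaloisGroup K, ∀ z ∈ N₀, σ • z ∈ N₀)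
    (hst₁ : ∀ σ : absoluteGaloisGroup K, ∀ z ∈ N₁, σ • z ∈ N₁)
    (hI₁ : ∃ σ : absoluteGaloisGroup K, ∃ z ∈ N₁, σ • z ≠ z) :
    ∀ σ : absoluteGaloisGroup K, ∀ z ∈ N₀, σ • z = z := by
  obtain ⟨φ, hsurj, hker, hequiv, -⟩ := uniformization_holds q hq0 hq
  obtain ⟨Nμ, hNμ, hμcard, hμstab⟩ :=
    exists_subgroup_coe_eq_image_rootsOfUnity hq0 hq φ hker hequiv hl.pos
  -- membership in `φ(μ_l)` is membership in `Nμ`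
  have hmemμ : ∀ (u : (AlgebraicClosure K)ˣ), u ^ l = 1 → φ (Additive.ofMul u) ∈ Nμ := by
    intro u hu
    have : φ (Additive.ofMul u) ∈ (Nμ : Set (geomPoints (tateCurve q))) := by
      rw [hNμ]; exact ⟨u, hu, rfl⟩
    exact this
  -- a stable line `N ≠ Nμ` of order `l` is pointwise fixed
  have key : ∀ N : AddSubgroup (geomPoints (tateCurve q)), Nat.card N = l →
      (∀ σ : absoluteGaloisGroup K, ∀ z ∈ N, σ • z ∈ N) → N ≠ Nμ →
      ∀ σ : absoluteGaloisGroup K, ∀ z ∈ N, σ • z = z := by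
    intro N hN hst hNne σ z hz
    refine smul_eq_of_mem_of_forall_not_mem_roots hq0 φ hsurj hker hequiv N hN hst ?_ σ hz
    intro Q hQ u hu huQ
    exact eq_zero_of_mem_of_mem_of_ne hl hN hμcard hNne hQ (huQ ▸ hmemμ u hu)
  by_cases h0 : N₀ = Nμ
  · exfalso
    have h1ne : N₁ ≠ Nμ := fun h ↦ hne (h0.trans h.symm)
    obtain ⟨σ, z, hz, hσz⟩ := hI₁
    exact hσz (key N₁ h₁ hst₁ h1ne σ z hz)
  · exact key N₀ h₀ hst₀ h0

end TateCurve

/-! ### §2. V.5.3 (b): `γ` a square in `K_v` ⇒ split multiplicative reduction -/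

section NumberField

open NumberField

/-- **Silverman *ATAEC* V.5.3 (b), (ii) ⇒ (iii), at a finite place of a number field.** For `W/K`
elliptic with multiplicative reduction at `v`: if `γ(W) = −c₄/c₆` is a square in `K_v`, then `W` has
SPLIT multiplicative reduction at `v` (the tree's proved `splitMultiplicative_tfae_holds` on `W ⊗ K_v`,
transported to the chosen local minimal model by `hasSplitMultiplicativeReduction_iff_of_isMinimal_of_eq
_smul` — the argument of `hasSplitMultiplicativeReductionAt_of_card_torsion_of_corV54`, extracted).
[cite: SilvermanATAEC1994, Thm. V.5.3 (b) (PDF pp. 407–409)] -/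
theorem hasSplitMultiplicativeReductionAt_of_isSquare_gamma {K : Type} [Field K] [NumberField K]
    (W : WeierstrassCurve K) [W.IsElliptic] (v : HeightOneSpectrum (𝓞 K))
    (hmult : W.HasMultiplicativeReductionAt v)
    (hsq : IsSquare (algebraMap K (v.adicCompletion K) (-(W.c₄ / W.c₆)))) :
    W.HasSplitMultiplicativeReductionAt v := by
  letI := Literature.NumberTheory.GaloisRepresentations.Ultrametric.AdicCompletion.nontriviallyNormedField K v
  haveI := charZero_adicCompletion' K v
  set E : WeierstrassCurve (v.adicCompletion K) := W.baseChange (v.adicCompletion K) with hE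
  haveI : E.IsElliptic := inferInstanceAs (W.map (algebraMap K (v.adicCompletion K))).IsElliptic
  have hγE : -(E.c₄ / E.c₆) = algebraMap K (v.adicCompletion K) (-(W.c₄ / W.c₆)) := by
    simp only [hE, WeierstrassCurve.baseChange, WeierstrassCurve.map_c₄, WeierstrassCurve.map_c₆,
      map_neg, map_div₀]
  have hsqE : IsSquare (-(E.c₄ / E.c₆)) := hγE ▸ hsq
  set D : WeierstrassCurve.VariableChange (v.adicCompletion K) :=
    (E.exists_isMinimal (v.adicCompletionIntegers K)).choose with hD
  have hX : W.localMinimalModel v = D • E := rfl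
  have hm : (W.localMinimalModel v).HasMultiplicativeReduction (v.adicCompletionIntegers K) := hmult
  haveI : (W.localMinimalModel v).IsElliptic := W.isElliptic_localMinimalModel v
  have hj1 : 1 < ‖(W.localMinimalModel v).j‖ :=
    one_lt_norm_j_of_hasMultiplicativeReduction_holds (v.adicCompletionIntegers K)
      (norm_le_one_iff_mem_range_adicCompletionIntegers K v) _ hm
  have hjeq : (W.localMinimalModel v).j = E.j := WeierstrassCurve.variableChange_j (C := D) (W := E)
  have hjE : 1 < ‖E.j‖ := hjeq ▸ hj1
  have htfae := splitMultiplicative_tfae_holds (v.adicCompletionIntegers K)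
    (norm_le_one_iff_mem_range_adicCompletionIntegers K v) E (tateParameter E hjE) hjE
    (tateParameter_ne_zero E hjE) (norm_tateParameter_lt_one E hjE) (tateJ_tateParameter E hjE)
  obtain ⟨C, hC⟩ := (htfae.out 1 2).mp hsqE
  haveI : WeierstrassCurve.IsMinimal (v.adicCompletionIntegers K) (C • E) :=
    hC.toHasMultiplicativeReduction.toIsMinimal
  have hrel : W.localMinimalModel v = (D * C⁻¹) • (C • E) := by
    rw [hX, smul_smul, inv_mul_cancel_right]
  have hΔ : (C • E).Δ ≠ 0 := (C • E).isUnit_Δ.ne_zero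
  exact (WeierstrassCurve.hasSplitMultiplicativeReduction_iff_of_isMinimal_of_eq_smul
    (v.adicCompletionIntegers K) hrel hΔ).mpr hC

/-- **At a NON-split multiplicative place some `σ ∈ Γ_{K_v}` moves `√γ`** (`γ = −c₄/c₆`): otherwise
`√γ ∈ K_v` (Galois theory of `K̄_v/K_v`, Mathlib `InfiniteGalois.mem_bot_iff_fixed`), `γ` is a square in
`K_v`, and V.5.3 (b) gives split reduction. [cite: SilvermanATAEC1994, Thm. V.5.3 (b), Cor. V.5.4 (PDF pp. 407–410)] -/
theorem exists_toAlgEquiv_ne_of_not_split {K : Type} [Field K] [NumberField K]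
    (W : WeierstrassCurve K) [W.IsElliptic] (v : HeightOneSpectrum (𝓞 K))
    (hmult : W.HasMultiplicativeReductionAt v) (hns : ¬ W.HasSplitMultiplicativeReductionAt v)
    {t : AlgebraicClosure (v.adicCompletion K)}
    (ht : t ^ 2 = algebraMap (v.adicCompletion K) (AlgebraicClosure (v.adicCompletion K))
      (algebraMap K (v.adicCompletion K) (-(W.c₄ / W.c₆)))) :
    ∃ σ : absoluteGaloisGroup (v.adicCompletion K),
      absoluteGaloisGroup.toAlgEquiv (v.adicCompletion K) σ t ≠ t := by
  haveI := charZero_adicCompletion' K v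
  by_contra hall'
  push Not at hall'
  apply hns
  have hall : ∀ f : AlgebraicClosure (v.adicCompletion K) ≃ₐ[v.adicCompletion K]
      AlgebraicClosure (v.adicCompletion K), f t = t := by
    intro f
    have := hall' ((absoluteGaloisGroup.toAlgEquiv (v.adicCompletion K)).symm f)
    simpa using this
  have htbot : t ∈ (⊥ : IntermediateField (v.adicCompletion K)
      (AlgebraicClosure (v.adicCompletion K))) :=
    (InfiniteGalois.mem_bot_iff_fixed t).mpr hall
  obtain ⟨t₀, ht₀⟩ := IntermediateField.mem_bot.mp htbot
  refine hasSplitMultiplicativeReductionAt_of_isSquare_gamma W v hmult ⟨t₀, ?_⟩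
  apply (algebraMap (v.adicCompletion K) (AlgebraicClosure (v.adicCompletion K))).injective
  rw [map_mul, ← sq]
  change _ = (algebraMap (v.adicCompletion K) (AlgebraicClosure (v.adicCompletion K)) t₀) ^ 2
  rw [ht₀, ht]


/-- **V.5.3 (a) + V.5.2 (c) packaged WITH the Tate parameter and the square root of `γ`.** As
`CornerLocal.exists_signEquiv_tateCurve` (`…TateParameter`), additionally producing `q` and recording
`t² = γ(W) = −c₄/c₆`: for `W/K` elliptic, multiplicative at `v`: a Tate parameter `q ∈ K_v` (`q ≠ 0`,
`‖q‖ < 1`, `j(E_q) = j(W)`), some `t ∈ K̄_v` with `t² = γ`, and an additive isomorphism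
`e : E(K̄_v) ≃+ E_q(K̄_v)` with `σ • e(P) = χ(σ) • e(σ • P)`, `χ(σ) = 1` iff `σ t = t`.
[cite: SilvermanATAEC1994, Lemma V.5.1, Lemma V.5.2 (c), Thm. V.5.3 (a) (PDF pp. 405–409)] -/
theorem exists_tateParameter_sq_eq_gamma_signEquiv {K : Type} [Field K] [NumberField K]
    (W : WeierstrassCurve K) [W.IsElliptic] {v : HeightOneSpectrum (𝓞 K)}
    (hmult : W.HasMultiplicativeReductionAt v) :
    ∃ (q : v.adicCompletion K) (t : AlgebraicClosure (v.adicCompletion K))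
      (e : localPoints W (v.adicCompletion K) ≃+ geomPoints (tateCurve q)),
      q ≠ 0 ∧ ‖q‖ < 1 ∧ tateJ q = (W.baseChange (v.adicCompletion K)).j ∧
      t ^ 2 = algebraMap (v.adicCompletion K) (AlgebraicClosure (v.adicCompletion K))
        (algebraMap K (v.adicCompletion K) (-(W.c₄ / W.c₆))) ∧
      ∀ (σ : absoluteGaloisGroup (v.adicCompletion K)) (P : localPoints W (v.adicCompletion K)),
        σ • e P =
          (if absoluteGaloisGroup.toAlgEquiv _ σ t = t then (1 : ℤ) else -1) • e (σ • P) := by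
  letI := Literature.NumberTheory.GaloisRepresentations.Ultrametric.AdicCompletion.nontriviallyNormedField K v
  haveI := charZero_adicCompletion' K v
  have hj := one_lt_norm_j_baseChange_of_hasMultiplicativeReductionAt W v hmult
  obtain ⟨hc₄, hc₆⟩ := c₄_ne_zero_and_c₆_ne_zero_of_hasMultiplicativeReductionAt W v hmult
  obtain ⟨q', hq0', hq', hqj', C, hC⟩ :=
    isomorphic_tateCurve_of_one_lt_norm_j_holds (W.baseChange (v.adicCompletion K)) hj
  obtain ⟨hEc₄, hEc₆⟩ := tateCurve_c₄_ne_zero_and_c₆_ne_zero W v hq0' hq' hqj' hj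
  obtain ⟨t, ht⟩ := IsAlgClosed.exists_pow_nat_eq
    (algebraMap (v.adicCompletion K) (AlgebraicClosure (v.adicCompletion K))
      (algebraMap K (v.adicCompletion K) (-(W.c₄ / W.c₆)))) two_pos
  obtain ⟨e, he⟩ : ∃ e : localPoints W (v.adicCompletion K) ≃+ geomPoints (tateCurve q'),
      ∀ P, e P = Affine.Point.congrEquiv hC (VariableChange.pointEquiv _ C
        (Affine.Point.congrEquiv (W.baseChange_baseChange_adicCompletion v).symm P)) :=
    ⟨(Affine.Point.congrEquiv (W.baseChange_baseChange_adicCompletion v).symm).trans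
      ((VariableChange.pointEquiv ((W.baseChange (v.adicCompletion K)).baseChange
        (AlgebraicClosure (v.adicCompletion K))) C).trans (Affine.Point.congrEquiv hC)),
      fun _ ↦ rfl⟩
  exact ⟨q', t, e, hq0', hq', hqj', ht, smul_eq_sign_smul W v hc₄ hc₆ hq' hEc₄ hEc₆ C hC ht e he⟩

end NumberField

end Literature.NumberTheory.EllipticCurves.TateCurve

end
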